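import Summits.NavierStokesRegularity.FluidComputer.GateBudgetMemberState
import HarnessLib

/-!
# What no tuning can beat, part 31: THE CLOCK'S DEBT — a doused trigger cannot re-ignite before
# the reversed clock has run back; no second pulse, and the output stays capped, for `2β/ε`

Cell `pub-fluidc`, blueprint seat bp1 (gen 32, first item); same namespace and conventions as
parts 1–30 (`GateBudget*.lean`); imports part 28 (`GateBudgetMemberState`, which carries parts
9–12: `clock_recovery`, `c_nonneg`, the energy identity, and the knob dictionary
`RotorKnob.rotorCircuit K M ε ρ = fiveGateCircuit ε (ρ²e^{-M}) (ε⁻¹M) (ρ⁻²) K`). Modes `0 = a`,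
`1 = b` clock, `2 = c` trigger/catalyst, `3 = d` transfer, `4 = ã` output.
HONEST FRAMING (verbatim): low prior, high value-of-information experiment on Tao's machine
paradigm; NOT a claim that NS blows up.

THE POINT (SPEC (3), second-pulse exclusion). Every cap of parts 12–30 after the dousing time
`T` lives on the SELF-TIMED window `[T, T + β/(2ε)]` on which the clock is still reversed
(`b ≤ -β/2`, `clock_stays_reversed`): with `β = ε/4` that is `1/8` of a time unit, and nothing
was typed about a member after `T + 1/8`. This part replaces the frozen-clock argument by an
INTEGRATING FACTOR THAT FOLLOWS THE RECOVERING CLOCK. If `b(T) ≤ -β` then `b(r) ≤ -β + ε(r - T)`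
for all `r ≥ T` (`clock_recovery`: the pump refills the clock at rate at most `εa² ≤ ε`), so
with `G(r) = μ(r - T)(ε(r - T)/2 - β)` (`G' = μ(ε(r - T) - β) ≥ μb`, `G(T) = 0`):
`(c·e^{-G})' = (σa² + μc(b + β - ε(r - T)))e^{-G} ≤ σe^{-G} ≤ σe^{μβ²/(2ε)}` (complete the
square: `-G ≤ μβ²/(2ε)`). §89 (`debt_trigger_law`): `c(t) ≤ e^{G(t)}(c(T) + σe^{μβ²/(2ε)}(t - T))`
for ALL `t ≥ T` — the trigger cannot exceed its doused level plus an exponentially small seed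
term until `G` turns positive, i.e. until `t = T + 2β/ε`: THE CLOCK'S DEBT `2β/ε` (the clock
must first climb back from `-β` through `0` to `+β` before the amplifier has undone the
dousing); on the DEBT WINDOW `[T, T + 2β/ε]` (`G ≤ 0`, `debt_trigger_window`):
`c(t) ≤ c(T) + σe^{μβ²/(2ε)}(t - T)` — NO SECOND PULSE. §90 (`debt_output_law`): the output pair
obeys `(d² + ã²)' = 2Rcad ≤ Rc` (energy `a² + d² ≤ 1`), hence on the debt window
`d(t)² + ã(t)² ≤ d(T)² + ã(T)² + R(c(T)(t - T) + σe^{μβ²/(2ε)}(t - T)²/2)` and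
(`debt_output_cap`) `ã(t)² ≤ 1 - a(T)² + (same dose)`: the carrier freeze of part 12 needed
`b ≤ 0` (its `-2εa²b` term), the output pair does not — it sees the trigger only. §91: the same
in knob units (`σ = ρ²e^{-M}`, `μ = M/ε`, `R = ρ⁻²`): seed term `ρ²e^{Mβ²/(2ε²) - M}`, dose
`u(T)(t - T) + e^{Mβ²/(2ε²) - M}(t - T)²/2` (`u = c/ρ²`), and behind a pin `|a(T)| ≥ L` with
`u(T) ≤ λ₀`: `ã(t)² ≤ 1 - L² + (2β/ε)λ₀ + e^{Mβ²/(2ε²) - M}(2β/ε)²/2` for EVERY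
`t ∈ [0, T + 2β/ε]` (`knob_debt_cap_of_pin`; monotone output before `T`). With part 28's
clock level `b(T) ≤ -0.69ε` (part 32) the debt window is `1.38` time units — eleven times the
self-timed `1/8` — at the cost `e^{-0.76M}` in the seed term.

HONEST LIMITS. (i) The law is one-sided: it bounds the trigger from ABOVE until `T + 2β/ε` and
says nothing after — there `G > 0` and the residue `c(T)e^{G}` may re-ignite; by the symmetry
of the parabola `G` the true second critical time is near `T + 2|b(T)|/ε`, and `|b(T)|` is
known here only through a lower bound `β`. (ii) The seed factor `e^{μβ²/(2ε)}` is the price of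
a constant majorant of `e^{-G}` (no Gaussian primitive is typed); in knob units it costs
`e^{Mβ²/(2ε²)}` against `e^{-M}`, harmless while `β < ε√2`, useless beyond. (iii) The output
dose uses `2ad ≤ a² + d² ≤ 1` and `c ≥ 0` only — no decay of `c` inside the window is used, so
the dose is linear in `c(T)(t - T)`, not `c(T)/(μβ)`. (iv) General laws only: no member, no
numbers (parts 32/33 feed part 28's state in). (v) Nothing about Navier–Stokes.
[cite: Tao2016AveragedNS, §5.5 Theorem 5.3, (5.5), (5.6), (b-eq), (c-eq), (energy-con)]
-/

noncomputable section

namespace Summit.NavierStokesRegularity.FluidComputer.GateBudget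

open Real Set Filter Topology
open Literature.Analysis.FluidPDE.Tao2016AveragedNS
open Literature.Analysis.FluidPDE.Tao2016AveragedNS.Thm53 (antitoneOn_intFactor
  antitoneOn_sub_of_deriv_le)

section FiveGate

variable {ε σ μ R K : ℝ} {X : ℝ → Fin 5 → ℝ}

/-! ## §89 The clock-debt law for the trigger -/

/-- **THE CLOCK'S DEBT (TRIGGER LAW).** Along `fiveGateCircuit ε σ μ R K` from (5.6) with
`0 < ε`, `0 ≤ σ`, `0 ≤ μ`: if the clock is doused at `T ≥ 0`, `b(T) ≤ -β`, then for EVERY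
`t ≥ T`, with `G(t) = μ(t - T)(ε(t - T)/2 - β)`:
`c(t) ≤ e^{G(t)}·(c(T) + σe^{μβ²/(2ε)}(t - T))` — integrating factor `e^{-G}` along the
recovering clock `b(r) ≤ -β + ε(r - T)` (`clock_recovery`), `c ≥ 0`, `σa² ≤ σ`, and
`-G ≤ μβ²/(2ε)`. `G < 0` exactly on `(T, T + 2β/ε)`: the debt window.
[cite: Tao2016AveragedNS, §5.5 Theorem 5.3, (5.5), (b-eq), (c-eq), proof ("comparison
argument")] -/
theorem debt_trigger_law (hX : ∀ t, HasDerivAt X (fiveGateCircuit ε σ μ R K (X t)) t)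
    (h0 : X 0 = delayInit) (hε : 0 < ε) (hσ : 0 ≤ σ) (hμ : 0 ≤ μ) {T β : ℝ} (hT : 0 ≤ T)
    (hbT : X T 1 ≤ -β) {t : ℝ} (ht : T ≤ t) :
    X t 2 ≤ exp (μ * (t - T) * (ε * (t - T) / 2 - β))
      * (X T 2 + σ * exp (μ * β ^ 2 / (2 * ε)) * (t - T)) := by
  have hanti := antitoneOn_intFactor (f := fun r => X r 2)
    (f' := fun r => σ * X r 0 ^ 2 + μ * X r 1 * X r 2)
    (g := fun r => μ * (ε * (r - T) - β))
    (G := fun r => μ * (r - T) * (ε * (r - T) / 2 - β))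
    (φ := fun _ => σ * exp (μ * β ^ 2 / (2 * ε)))
    (Φ := fun r => σ * exp (μ * β ^ 2 / (2 * ε)) * r) (convex_Ici T)
    (fun r _ => hasDerivAt_c hX r)
    (fun r _ => by
      have h1 : HasDerivAt (fun x => μ * (x - T) * (ε * (x - T) / 2 - β))
          (μ * 1 * (ε * (r - T) / 2 - β) + μ * (r - T) * (ε * 1 / 2)) r :=
        (((hasDerivAt_id' r).sub_const T).const_mul μ).mul
          ((((hasDerivAt_id' r).sub_const T).const_mul ε).div_const 2 |>.sub_const β)
      exact h1.congr_deriv (by ring))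
    (fun r _ => ((hasDerivAt_id' r).const_mul _).congr_deriv (by simp))
    (fun r hr => by
      have hr' : T ≤ r := hr
      have hc0 : 0 ≤ X r 2 := c_nonneg hX h0 hσ (hT.trans hr')
      have ha : X r 0 ^ 2 ≤ 1 := traj_sq_le_one hX h0 r 0
      have hb : X r 1 ≤ -β + ε * (r - T) := by
        have := clock_recovery hX h0 hε.le hμ hr'
        linarith
      -- `c' - G'c = σa² + μc·(b + β - ε(r - T)) ≤ σ`
      have h1 : σ * X r 0 ^ 2 + μ * X r 1 * X r 2 - μ * (ε * (r - T) - β) * X r 2 ≤ σ := by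
        have : μ * X r 2 * (X r 1 + β - ε * (r - T)) ≤ 0 :=
          mul_nonpos_of_nonneg_of_nonpos (mul_nonneg hμ hc0) (by linarith)
        nlinarith [mul_le_mul_of_nonneg_left ha hσ]
      -- `-G(r) ≤ μβ²/(2ε)`: complete the square
      have h2 : -(μ * (r - T) * (ε * (r - T) / 2 - β)) ≤ μ * β ^ 2 / (2 * ε) := by
        rw [le_div_iff₀ (by positivity)]
        nlinarith [mul_nonneg hμ (sq_nonneg (β - ε * (r - T)))]
      show (σ * X r 0 ^ 2 + μ * X r 1 * X r 2 - μ * (ε * (r - T) - β) * X r 2)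
          * exp (-(μ * (r - T) * (ε * (r - T) / 2 - β))) ≤ σ * exp (μ * β ^ 2 / (2 * ε))
      exact le_trans (mul_le_mul_of_nonneg_right h1 (exp_pos _).le)
        (mul_le_mul_of_nonneg_left (exp_le_exp.2 h2) hσ))
  have h := hanti (self_mem_Ici (a := T)) (mem_Ici.2 ht) ht
  dsimp only at h
  rw [show μ * (T - T) * (ε * (T - T) / 2 - β) = 0 by ring, neg_zero, exp_zero, mul_one] at h
  have hpos : 0 < exp (μ * (t - T) * (ε * (t - T) / 2 - β)) := exp_pos _
  have hE : exp (-(μ * (t - T) * (ε * (t - T) / 2 - β)))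
      * exp (μ * (t - T) * (ε * (t - T) / 2 - β)) = 1 := by
    rw [← exp_add, neg_add_cancel, exp_zero]
  calc X t 2 = X t 2 * exp (-(μ * (t - T) * (ε * (t - T) / 2 - β)))
        * exp (μ * (t - T) * (ε * (t - T) / 2 - β)) := by rw [mul_assoc, hE, mul_one]
    _ ≤ (X T 2 + σ * exp (μ * β ^ 2 / (2 * ε)) * (t - T))
        * exp (μ * (t - T) * (ε * (t - T) / 2 - β)) :=
      mul_le_mul_of_nonneg_right (by linarith) hpos.le
    _ = _ := mul_comm _ _

/-- **NO SECOND PULSE INSIDE THE DEBT WINDOW.** Same hypotheses: for every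
`t ∈ [T, T + 2β/ε]`, `c(t) ≤ c(T) + σe^{μβ²/(2ε)}(t - T)` — on the debt window `G(t) ≤ 0`, so
`e^{G} ≤ 1` in `debt_trigger_law`. With `β ≍ ε` and `σ = e^{-M}`-small the trigger stays at its
doused level for ORDER ONE time, not `β/(2ε)`.
[cite: Tao2016AveragedNS, §5.5 Theorem 5.3, (5.5), (b-eq), (c-eq)] -/
theorem debt_trigger_window (hX : ∀ t, HasDerivAt X (fiveGateCircuit ε σ μ R K (X t)) t)
    (h0 : X 0 = delayInit) (hε : 0 < ε) (hσ : 0 ≤ σ) (hμ : 0 ≤ μ) {T β : ℝ} (hT : 0 ≤ T)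
    (hbT : X T 1 ≤ -β) {t : ℝ} (ht : t ∈ Icc T (T + 2 * β / ε)) :
    X t 2 ≤ X T 2 + σ * exp (μ * β ^ 2 / (2 * ε)) * (t - T) := by
  have h := debt_trigger_law hX h0 hε hσ hμ hT hbT ht.1
  have hG : μ * (t - T) * (ε * (t - T) / 2 - β) ≤ 0 := by
    have h1 : 0 ≤ μ * (t - T) := mul_nonneg hμ (by linarith [ht.1])
    have h3 : t - T ≤ 2 * β / ε := by linarith [ht.2]
    have h4 : ε * (t - T) ≤ 2 * β :=
      calc ε * (t - T) ≤ ε * (2 * β / ε) := mul_le_mul_of_nonneg_left h3 hε.le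
        _ = 2 * β := by field_simp
    exact mul_nonpos_of_nonneg_of_nonpos h1 (by linarith)
  have hexp : exp (μ * (t - T) * (ε * (t - T) / 2 - β)) ≤ 1 := exp_le_one_iff.2 hG
  have hS : 0 ≤ X T 2 + σ * exp (μ * β ^ 2 / (2 * ε)) * (t - T) :=
    add_nonneg (c_nonneg hX h0 hσ hT) (mul_nonneg (by positivity) (by linarith [ht.1]))
  calc X t 2 ≤ _ := h
    _ ≤ 1 * (X T 2 + σ * exp (μ * β ^ 2 / (2 * ε)) * (t - T)) :=
      mul_le_mul_of_nonneg_right hexp hS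
    _ = _ := one_mul _

/-! ## §90 The clock-debt law for the output pair -/

/-- **THE OUTPUT PAIR ON THE DEBT WINDOW.** Same hypotheses and `0 ≤ R`: for every
`t ∈ [T, T + 2β/ε]`,
`d(t)² + ã(t)² ≤ d(T)² + ã(T)² + R·(c(T)(t - T) + σe^{μβ²/(2ε)}(t - T)²/2)` —
`(d² + ã²)' = 2Rcad ≤ Rc` (`out_energy`; `2ad ≤ a² + d² ≤ 1` by the energy identity, `c ≥ 0`)
and `debt_trigger_window`. No sign of `b` is needed: the output pair sees the trigger only.
[cite: Tao2016AveragedNS, §5.5 Theorem 5.3, (5.5), (c-eq), (energy-con)] -/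
theorem debt_output_law (hX : ∀ t, HasDerivAt X (fiveGateCircuit ε σ μ R K (X t)) t)
    (h0 : X 0 = delayInit) (hε : 0 < ε) (hσ : 0 ≤ σ) (hμ : 0 ≤ μ) (hR : 0 ≤ R) {T β : ℝ}
    (hT : 0 ≤ T) (hbT : X T 1 ≤ -β) {t : ℝ} (ht : t ∈ Icc T (T + 2 * β / ε)) :
    X t 3 ^ 2 + X t 4 ^ 2 ≤ X T 3 ^ 2 + X T 4 ^ 2
      + R * (X T 2 * (t - T) + σ * exp (μ * β ^ 2 / (2 * ε)) * (t - T) ^ 2 / 2) := by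
  have hanti := antitoneOn_sub_of_deriv_le (f := fun r => X r 3 ^ 2 + X r 4 ^ 2)
    (f' := fun r => 2 * R * X r 2 * X r 0 * X r 3)
    (φ := fun r => R * (X T 2 + σ * exp (μ * β ^ 2 / (2 * ε)) * (r - T)))
    (Φ := fun r => R * (X T 2 * (r - T) + σ * exp (μ * β ^ 2 / (2 * ε)) * (r - T) ^ 2 / 2))
    (convex_Icc T (T + 2 * β / ε)) (fun r _ => out_energy (hX r))
    (fun r _ => by
      have h1 : HasDerivAt
          (fun x => R * (X T 2 * (x - T) + σ * exp (μ * β ^ 2 / (2 * ε)) * (x - T) ^ 2 / 2))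
          (R * (X T 2 * 1 + σ * exp (μ * β ^ 2 / (2 * ε)) * (↑(2 : ℕ) * (r - T) ^ (2 - 1) * 1)
            / 2)) r :=
        ((((hasDerivAt_id' r).sub_const T).const_mul (X T 2)).add
          (((((hasDerivAt_id' r).sub_const T).pow 2).const_mul _).div_const 2)).const_mul R
      refine h1.congr_deriv ?_
      simp only [show (2 : ℕ) - 1 = 1 from rfl, pow_one, Nat.cast_ofNat]
      ring)
    (fun r hr => by
      have hc0 : 0 ≤ X r 2 := c_nonneg hX h0 hσ (hT.trans hr.1)
      have hcr := debt_trigger_window hX h0 hε hσ hμ hT hbT hr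
      have hE : X r 0 ^ 2 + X r 1 ^ 2 + X r 2 ^ 2 + X r 3 ^ 2 + X r 4 ^ 2 = 1 := by
        simpa [energy, Fin.sum_univ_five] using energy_init hX h0 r
      have had : 2 * (X r 0 * X r 3) ≤ 1 := by
        nlinarith [sq_nonneg (X r 0 - X r 3), sq_nonneg (X r 1), sq_nonneg (X r 2),
          sq_nonneg (X r 4)]
      show 2 * R * X r 2 * X r 0 * X r 3
          ≤ R * (X T 2 + σ * exp (μ * β ^ 2 / (2 * ε)) * (r - T))
      have h1 : 2 * R * X r 2 * X r 0 * X r 3 ≤ R * X r 2 := by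
        have := mul_le_mul_of_nonneg_left had (mul_nonneg hR hc0)
        nlinarith [this]
      exact h1.trans (mul_le_mul_of_nonneg_left hcr hR))
  have h := hanti (left_mem_Icc.2 (ht.1.trans ht.2)) ht ht.1
  dsimp only at h
  have hΦT : R * (X T 2 * (T - T) + σ * exp (μ * β ^ 2 / (2 * ε)) * (T - T) ^ 2 / 2) = 0 := by
    ring
  linarith

/-- **THE OUTPUT CAP ON THE DEBT WINDOW.** Same hypotheses: for every `t ∈ [T, T + 2β/ε]`,
`ã(t)² ≤ 1 - a(T)² + R·(c(T)(t - T) + σe^{μβ²/(2ε)}(t - T)²/2)` — `debt_output_law`, the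
energy identity at `T` (`d(T)² + ã(T)² ≤ 1 - a(T)²`) and `ã² ≤ d² + ã²`. Part 12's
`afterglow_selftimed` on `[T, T + β/(2ε)]`, now on a window FOUR TIMES `β/ε` long.
[cite: Tao2016AveragedNS, §5.5 Theorem 5.3, (5.5), (c-eq), (energy-con)] -/
theorem debt_output_cap (hX : ∀ t, HasDerivAt X (fiveGateCircuit ε σ μ R K (X t)) t)
    (h0 : X 0 = delayInit) (hε : 0 < ε) (hσ : 0 ≤ σ) (hμ : 0 ≤ μ) (hR : 0 ≤ R) {T β : ℝ}
    (hT : 0 ≤ T) (hbT : X T 1 ≤ -β) {t : ℝ} (ht : t ∈ Icc T (T + 2 * β / ε)) :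
    X t 4 ^ 2 ≤ 1 - X T 0 ^ 2
      + R * (X T 2 * (t - T) + σ * exp (μ * β ^ 2 / (2 * ε)) * (t - T) ^ 2 / 2) := by
  have h := debt_output_law hX h0 hε hσ hμ hR hT hbT ht
  have hE : X T 0 ^ 2 + X T 1 ^ 2 + X T 2 ^ 2 + X T 3 ^ 2 + X T 4 ^ 2 = 1 := by
    simpa [energy, Fin.sum_univ_five] using energy_init hX h0 T
  nlinarith [sq_nonneg (X T 1), sq_nonneg (X T 2), sq_nonneg (X t 3)]

end FiveGate

/-! ## §91 The clock's debt in knob units -/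

section Knob

variable {K M ε ρ : ℝ} {X : ℝ → Fin 5 → ℝ}

/-- **THE CLOCK'S DEBT OF A KNOB MEMBER (TRIGGER).** Along `rotorCircuit K M ε ρ` from (5.6)
(`0 < ε`, `0 < ρ`, `0 ≤ M`), if `b(T) ≤ -β` at `T ≥ 0` then for every `t ∈ [T, T + 2β/ε]`:
`c(t) ≤ c(T) + ρ²e^{Mβ²/(2ε²) - M}(t - T)` — `debt_trigger_window` with `σ = ρ²e^{-M}`,
`μ = M/ε`. At `β = 0.69ε`: window `1.38`, seed factor `e^{-0.76195M}`.
[cite: Tao2016AveragedNS, §5.5 Theorem 5.3, (5.5), (b-eq), (c-eq)] -/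
theorem knob_debt_trigger (hX : ∀ t, HasDerivAt X (RotorKnob.rotorCircuit K M ε ρ (X t)) t)
    (h0 : X 0 = delayInit) (hε : 0 < ε) (hρ : 0 < ρ) (hM : 0 ≤ M) {T β : ℝ} (hT : 0 ≤ T)
    (hbT : X T 1 ≤ -β) {t : ℝ} (ht : t ∈ Icc T (T + 2 * β / ε)) :
    X t 2 ≤ X T 2 + ρ ^ 2 * exp (M * β ^ 2 / (2 * ε ^ 2) - M) * (t - T) := by
  have hXf := hX
  rw [RotorKnob.rotorCircuit_eq_fiveGate] at hXf
  have hε0 : ε ≠ 0 := hε.ne'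
  have h := debt_trigger_window hXf h0 hε (by positivity) (by positivity) hT hbT ht
  have hE : exp (-M) * exp (ε⁻¹ * M * β ^ 2 / (2 * ε)) = exp (M * β ^ 2 / (2 * ε ^ 2) - M) := by
    rw [← exp_add]
    congr 1
    field_simp
    ring
  exact h.trans_eq (by rw [← hE]; ring)

/-- **THE SHARP FORM, ALL `t ≥ T`.** Same hypotheses: for every `t ≥ T`,
`c(t) ≤ e^{M(t - T)((t - T)/2 - β/ε)}·(c(T) + ρ²e^{Mβ²/(2ε²) - M}(t - T))` — `debt_trigger_law`
in knob units; the exponent is negative exactly on `(T, T + 2β/ε)` and the bound is void soon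
after (HONEST LIMIT (i)).
[cite: Tao2016AveragedNS, §5.5 Theorem 5.3, (5.5), (b-eq), (c-eq)] -/
theorem knob_debt_trigger_law (hX : ∀ t, HasDerivAt X (RotorKnob.rotorCircuit K M ε ρ (X t)) t)
    (h0 : X 0 = delayInit) (hε : 0 < ε) (hρ : 0 < ρ) (hM : 0 ≤ M) {T β : ℝ} (hT : 0 ≤ T)
    (hbT : X T 1 ≤ -β) {t : ℝ} (ht : T ≤ t) :
    X t 2 ≤ exp (M * (t - T) * ((t - T) / 2 - β / ε))
      * (X T 2 + ρ ^ 2 * exp (M * β ^ 2 / (2 * ε ^ 2) - M) * (t - T)) := by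
  have hXf := hX
  rw [RotorKnob.rotorCircuit_eq_fiveGate] at hXf
  have hε0 : ε ≠ 0 := hε.ne'
  have h := debt_trigger_law hXf h0 hε (by positivity) (by positivity) hT hbT ht
  have hE : exp (-M) * exp (ε⁻¹ * M * β ^ 2 / (2 * ε)) = exp (M * β ^ 2 / (2 * ε ^ 2) - M) := by
    rw [← exp_add]
    congr 1
    field_simp
    ring
  have hG : ε⁻¹ * M * (t - T) * (ε * (t - T) / 2 - β) = M * (t - T) * ((t - T) / 2 - β / ε) := by
    field_simp
  rw [hG] at h
  exact h.trans_eq (by rw [← hE]; ring)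

/-- **THE OUTPUT PAIR OF A KNOB MEMBER ON THE DEBT WINDOW.** Same hypotheses: for every
`t ∈ [T, T + 2β/ε]`, with `u(T) = c(T)/ρ²`:
`d(t)² + ã(t)² ≤ d(T)² + ã(T)² + u(T)(t - T) + e^{Mβ²/(2ε²) - M}(t - T)²/2` —
`debt_output_law` with `R = ρ⁻²`, `σ = ρ²e^{-M}`, `μ = M/ε`.
[cite: Tao2016AveragedNS, §5.5 Theorem 5.3, (5.5), (c-eq), (energy-con)] -/
theorem knob_debt_output (hX : ∀ t, HasDerivAt X (RotorKnob.rotorCircuit K M ε ρ (X t)) t)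
    (h0 : X 0 = delayInit) (hε : 0 < ε) (hρ : 0 < ρ) (hM : 0 ≤ M) {T β : ℝ} (hT : 0 ≤ T)
    (hbT : X T 1 ≤ -β) {t : ℝ} (ht : t ∈ Icc T (T + 2 * β / ε)) :
    X t 3 ^ 2 + X t 4 ^ 2 ≤ X T 3 ^ 2 + X T 4 ^ 2
      + (X T 2 / ρ ^ 2 * (t - T) + exp (M * β ^ 2 / (2 * ε ^ 2) - M) * (t - T) ^ 2 / 2) := by
  have hXf := hX
  rw [RotorKnob.rotorCircuit_eq_fiveGate] at hXf
  have hε0 : ε ≠ 0 := hε.ne'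
  have hρ0 : ρ ^ 2 ≠ 0 := by positivity
  have h := debt_output_law hXf h0 hε (by positivity) (by positivity) (by positivity) hT hbT ht
  have hE : exp (-M) * exp (ε⁻¹ * M * β ^ 2 / (2 * ε)) = exp (M * β ^ 2 / (2 * ε ^ 2) - M) := by
    rw [← exp_add]
    congr 1
    field_simp
    ring
  exact h.trans_eq (by rw [← hE]; field_simp)

/-- **THE CAP OF A KNOB MEMBER BEHIND A PIN, ON THE WHOLE DEBT WINDOW.** Along
`rotorCircuit K M ε ρ` from (5.6) (`0 < ε`, `0 < ρ`, `0 ≤ M`, `0 ≤ K`): if at `T ≥ 0` the clock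
is doused `b(T) ≤ -β ≤ 0`, the residue is `u(T) ≤ λ₀` and the input mode is pinned
`|a(T)| ≥ L ≥ 0`, then for EVERY `t ∈ [0, T + 2β/ε]`:
`ã(t)² ≤ 1 - L² + (2β/ε)λ₀ + e^{Mβ²/(2ε²) - M}(2β/ε)²/2` — monotone output before `T`,
`knob_debt_output` and the energy identity after. Part 25a's `knob_member_cap_of_pin` had the
window `β/(2ε)` and the afterglow `4ε(λ₀ + ε)/(Mβ) + 4e^{-M}/M`.
[cite: Tao2016AveragedNS, §5.5 Theorem 5.3, (5.5), (c-eq), (energy-con)] -/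
theorem knob_debt_cap_of_pin (hX : ∀ t, HasDerivAt X (RotorKnob.rotorCircuit K M ε ρ (X t)) t)
    (h0 : X 0 = delayInit) (hε : 0 < ε) (hρ : 0 < ρ) (hM : 0 ≤ M) (hK : 0 ≤ K)
    {T β lam₀ L : ℝ} (hT : 0 ≤ T) (hβ : 0 ≤ β) (hbT : X T 1 ≤ -β) (hcl : X T 2 ≤ lam₀ * ρ ^ 2)
    (hL : 0 ≤ L) (hpin : L ≤ |X T 0|) {t : ℝ} (ht : t ∈ Icc 0 (T + 2 * β / ε)) :
    X t 4 ^ 2 ≤ 1 - L ^ 2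
      + (2 * β / ε * lam₀ + exp (M * β ^ 2 / (2 * ε ^ 2) - M) * (2 * β / ε) ^ 2 / 2) := by
  have hsq : ∀ s, X s 3 ^ 2 + X s 4 ^ 2 ≤ 1 - X s 0 ^ 2 := fun s => by
    have := RotorKnob.traj_sum_sq_eq_one hX h0 s
    nlinarith [sq_nonneg (X s 1), sq_nonneg (X s 2)]
  have hsqa : L ^ 2 ≤ X T 0 ^ 2 := by
    rw [← sq_abs (X T 0)]
    exact pow_le_pow_left₀ hL hpin 2
  have hu : X T 2 / ρ ^ 2 ≤ lam₀ := by rwa [div_le_iff₀ (by positivity)]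
  have hu0 : 0 ≤ X T 2 / ρ ^ 2 := div_nonneg (RotorKnob.c_nonneg hX h0 hT) (by positivity)
  have hW : 0 ≤ 2 * β / ε := by positivity
  have hdose : 0 ≤ 2 * β / ε * lam₀ + exp (M * β ^ 2 / (2 * ε ^ 2) - M) * (2 * β / ε) ^ 2 / 2 :=
    add_nonneg (mul_nonneg hW (hu0.trans hu)) (by positivity)
  rcases le_total t T with htT | hTt
  · -- before the dousing time the output is monotone: `ã(t)² ≤ ã(T)² ≤ 1 - a(T)²`
    have hmono : X t 4 ≤ X T 4 := RotorKnob.rotorCircuit_output_monotone hK hX htT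
    have h0t : 0 ≤ X t 4 := RotorKnob.e_nonneg hX h0 hK ht.1
    have hT4 : X t 4 ^ 2 ≤ X T 4 ^ 2 := by nlinarith [mul_self_le_mul_self h0t hmono]
    nlinarith [hsq T, sq_nonneg (X T 3)]
  · have h := knob_debt_output hX h0 hε hρ hM hT hbT ⟨hTt, ht.2⟩
    have h1 : t - T ≤ 2 * β / ε := by linarith [ht.2]
    have h0' : 0 ≤ t - T := by linarith
    have hA : X T 2 / ρ ^ 2 * (t - T) ≤ 2 * β / ε * lam₀ := by
      rw [mul_comm (2 * β / ε)]
      exact mul_le_mul hu h1 h0' (hu0.trans hu)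
    have hB : exp (M * β ^ 2 / (2 * ε ^ 2) - M) * (t - T) ^ 2 / 2
        ≤ exp (M * β ^ 2 / (2 * ε ^ 2) - M) * (2 * β / ε) ^ 2 / 2 := by
      have : (t - T) ^ 2 ≤ (2 * β / ε) ^ 2 := pow_le_pow_left₀ h0' h1 2
      have := mul_le_mul_of_nonneg_left this (exp_pos (M * β ^ 2 / (2 * ε ^ 2) - M)).le
      linarith
    nlinarith [hsq T, sq_nonneg (X t 3)]

end Knob

end Summit.NavierStokesRegularity.FluidComputer.GateBudget
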